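import Summits.Ventures.PercRepro.S1TriangleFive
import Summits.Ventures.PercRepro.RankLevelSetPlaneTen

/-!
# PercRepro — LEMMA Q: the triangle count at bounded nullity under the line, plane and solid bounds (p2, gen 17)

Under (C1) (rank-`2` sets have `≤ 3` points), (C2) (rank-`≤ 3` sets have `≤ 6` points) and (C3) (rank-`≤ 4` sets
have `≤ 10` points — the three facts of the `e`-free core) a finite matroid of nullity `d` has at most `cq d`
triangles, where `cq = 0, 1, 2, 4, 5, 7, 10, 13, 16, 20, 25, 30, 36, 43, 51, 60, 70, 81, 93, 106, 120, 135, 151, 169, 188,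
208, 230, 253, 278, 304` for `d = 0 … 29` and `cq d = d(d+1)/2` (LEMMA T) beyond. Against the cell's earlier bounds at `d = 8, 9, 10, 12, 17`: `16 / 20 / 25 / 36 / 81` in place of `23 / 30 / 38 / 57 / 125`
(LEMMA T⁺⁺⁺); the computed TRIANGLE CAP has `P(7) = 11`, `P(8) = 13` where `cq` gives `13 / 16`.

THE ARGUMENT (induction on `|E|`). A coloop lies on no triangle and its deletion keeps the nullity, so the matroid
may be taken coloop-free. Its rank `r` and size `m = r + d` satisfy: `r ≥ 2` if there is a triangle; `r = 2 ⇒ m ≤ 3`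
(C1), `r = 3 ⇒ m ≤ 6` (C2), `r = 4 ⇒ m ≤ 10` (C3) — hence `m ≥ m0 d`, the least size of a matroid of nullity `d`
carrying a triangle (`m0 = d + 2, d + 3, d + 4, d + 5` for `d ≤ 1`, `d ≤ 3`, `d ≤ 6`, `d ≥ 7`). Some point `x` lies
on at most `⌊3·s₃/m⌋ ≤ ⌊3·s₃/m0 d⌋` triangles (the average degree is `3·s₃/m`); deleting it,
`s₃ ≤ ⌊3·s₃/m0 d⌋ + cq (d − 1)`, which forces `s₃ ≤ cq d` — a finite check, `decide`. The base `d = 4` is p1's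
`T(4) = 5` (`ncard_triangles_le_five_of_nullity_four`); `d = 1` and `d ≥ 30` are LEMMA T.

* `m0`, `cq` — the least size and the bound;
* `cq_step` — the finite check (`decide`);
* **`ncard_triangles_le_cq`** — `s₃ ≤ cq d` under (C1), (C2), (C3);
* **`core_ncard_triangles_le_cq`** — the same on the `e`-free core, in the set-builder vocabulary of `S1RowTwelve`.
Axioms: standard.
-/

open scoped Matroid

namespace PercRepro

namespace S1

open Set

variable {α : Type}

/-- `m0 d`: the least number of points of a matroid of nullity `d` with a triangle, under (C1)–(C3). -/
def m0 (d : ℕ) : ℕ := if d ≤ 1 then d + 2 else if d ≤ 3 then d + 3 else if d ≤ 6 then d + 4 else d + 5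

/-- `cq d`: the triangle bound at nullity `d` of LEMMA Q (the table for `d ≤ 29`, LEMMA T's `d(d+1)/2` beyond). -/
def cq (d : ℕ) : ℕ :=
  if d ≤ 29 then
    [0, 1, 2, 4, 5, 7, 10, 13, 16, 20, 25, 30, 36, 43, 51, 60, 70, 81, 93, 106, 120, 135, 151, 169, 188, 208,
      230, 253, 278, 304].getD d 0
  else d * (d + 1) / 2

/-- LEMMA T's bound dominates `cq`. -/
theorem cq_le_T (d : ℕ) : cq d ≤ d * (d + 1) / 2 := by
  unfold cq
  split_ifs with h
  · interval_cases d <;> decide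
  · exact le_rfl

/-- **The finite check of the recursion**: for `1 ≤ d ≤ 28`, `d + 1 ≠ 4`, every `s ≤ 4·cq d` with
`s ≤ ⌊3s / m0 (d + 1)⌋ + cq d` satisfies `s ≤ cq (d + 1)`. -/
theorem cq_step : ∀ d < 29, 1 ≤ d → d + 1 ≠ 4 →
    ∀ s < 4 * cq d + 1, s ≤ 3 * s / m0 (d + 1) + cq d → s ≤ cq (d + 1) := by
  decide +kernel

/-- `m0 d ≥ 4` for `d ≥ 2`. -/
theorem four_le_m0 {d : ℕ} (hd : 2 ≤ d) : 4 ≤ m0 d := by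
  unfold m0
  split_ifs <;> omega

/-- **LEMMA Q.** Under (C1), (C2), (C3), a finite matroid with `|E| = r(E) + d` has at most `cq d` triangles. -/
theorem ncard_triangles_le_cq (M : Matroid α) [M.Finite]
    (hC1 : ∀ L ⊆ M.E, M.eRk L = 2 → L.ncard ≤ 3) (hC2 : ∀ P ⊆ M.E, M.eRk P ≤ 3 → P.ncard ≤ 6)
    (hC3 : ∀ X ⊆ M.E, M.eRk X ≤ 4 → X.ncard ≤ 10) {d : ℕ} (hd : M.E.encard = M.eRank + d) :
    (ThmN.triangles M).ncard ≤ cq d := by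
  suffices H : ∀ n : ℕ, ∀ (M : Matroid α) [M.Finite], M.E.ncard = n →
      (∀ L ⊆ M.E, M.eRk L = 2 → L.ncard ≤ 3) → (∀ P ⊆ M.E, M.eRk P ≤ 3 → P.ncard ≤ 6) →
      (∀ X ⊆ M.E, M.eRk X ≤ 4 → X.ncard ≤ 10) →
      ∀ d : ℕ, M.E.encard = M.eRank + d → (ThmN.triangles M).ncard ≤ cq d from
    H _ M rfl hC1 hC2 hC3 d hd
  intro n
  induction n using Nat.strong_induction_on with
  | _ n ih =>
  intro M _ hn hC1 hC2 hC3 d hd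
  classical
  -- LEMMA T covers `d = 0`, `d = 1` and `d ≥ 30`
  have hT : 2 * (ThmN.triangles M).ncard ≤ d * (d + 1) := two_mul_ncard_triangles_le M hC1 hd
  by_cases hd13 : 30 ≤ d
  · have : cq d = d * (d + 1) / 2 := by unfold cq; rw [if_neg (by omega)]
    rw [this]
    omega
  by_cases hd1 : d ≤ 1
  · have : cq d = d := by
      unfold cq
      rw [if_pos (by omega)]
      interval_cases d <;> rfl
    rw [this]
    rcases Nat.le_one_iff_eq_zero_or_eq_one.1 hd1 with h | h <;> subst h <;> omega
  -- `2 ≤ d ≤ 29` from here; if there is no triangle, nothing to prove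
  by_cases hs0 : (ThmN.triangles M).ncard = 0
  · rw [hs0]; exact Nat.zero_le _
  have hSfin : (ThmN.triangles M).Finite :=
    M.ground_finite.finite_subsets.subset (fun C hC => hC.1.subset_ground)
  obtain ⟨C, hC⟩ : (ThmN.triangles M).Nonempty := by
    rw [← Set.ncard_pos hSfin]; omega
  -- the rank facts: `r ≥ 2`, `m = r + d`, and `r = 2 / 3 / 4 ⇒ m ≤ 3 / 6 / 10`
  obtain ⟨r, hr, hnr, hr2⟩ := two_add_le_eRank_of_triangle M hd hC
  have hE2 : r ≠ 2 ∨ M.E.ncard ≤ 3 := by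
    by_cases h : r = 2
    · refine Or.inr (hC1 M.E (subset_refl _) ?_)
      rw [← _root_.Matroid.eRank_def, hr, h]; norm_num
    · exact Or.inl h
  have hE3 : r ≠ 3 ∨ M.E.ncard ≤ 6 := by
    by_cases h : r = 3
    · refine Or.inr (hC2 M.E (subset_refl _) ?_)
      rw [← _root_.Matroid.eRank_def, hr, h]; norm_num
    · exact Or.inl h
  have hE4 : r ≠ 4 ∨ M.E.ncard ≤ 10 := by
    by_cases h : r = 4
    · refine Or.inr (hC3 M.E (subset_refl _) ?_)
      rw [← _root_.Matroid.eRank_def, hr, h]; norm_num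
    · exact Or.inl h
  have hm0 : m0 d ≤ M.E.ncard := by
    unfold m0
    split_ifs <;> omega
  -- a coloop: delete it and use the induction hypothesis
  by_cases hcol : ∃ k ∈ M.E, M.IsColoop k
  · obtain ⟨k, hkE, hk⟩ := hcol
    have hlt : (M ＼ {k}).E.ncard < n := by
      rw [_root_.Matroid.delete_ground, ← hn]
      exact Set.ncard_sdiff_singleton_lt_of_mem hkE M.ground_finite
    have hC1' : ∀ L ⊆ (M ＼ {k}).E, (M ＼ {k}).eRk L = 2 → L.ncard ≤ 3 := by
      intro L hL hr
      rw [_root_.Matroid.delete_ground] at hL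
      rw [delete_singleton_eRk_eq hL] at hr
      exact hC1 L (hL.trans Set.sdiff_subset) hr
    have hC2' : ∀ P ⊆ (M ＼ {k}).E, (M ＼ {k}).eRk P ≤ 3 → P.ncard ≤ 6 := by
      intro P hP hr
      rw [_root_.Matroid.delete_ground] at hP
      rw [delete_singleton_eRk_eq hP] at hr
      exact hC2 P (hP.trans Set.sdiff_subset) hr
    have hC3' : ∀ X ⊆ (M ＼ {k}).E, (M ＼ {k}).eRk X ≤ 4 → X.ncard ≤ 10 := by
      intro X hX hr
      rw [_root_.Matroid.delete_ground] at hX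
      rw [delete_singleton_eRk_eq hX] at hr
      exact hC3 X (hX.trans Set.sdiff_subset) hr
    have hd' : (M ＼ {k}).E.encard = (M ＼ {k}).eRank + d := encard_delete_eq_of_isColoop M hk hd
    have := ih _ hlt (M ＼ {k}) rfl hC1' hC2' hC3' d hd'
    rwa [triangles_delete_eq_of_isColoop M hk] at this
  have hcol' : ∀ x ∈ M.E, ¬ M.IsColoop x := fun x hx h => hcol ⟨x, hx, h⟩
  -- `d = 4` is `T(4) = 5`
  by_cases hd4 : d = 4
  · subst hd4
    have : cq 4 = 5 := by decide
    rw [this]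
    exact ncard_triangles_le_five_of_nullity_four M hC1 hC2 hd
  -- the coloop-free step: a point of degree `≤ ⌊3·s₃/m⌋` exists
  have hm4 : 4 ≤ M.E.ncard := (four_le_m0 (by omega)).trans hm0
  obtain ⟨x, hxE, hx⟩ : ∃ x ∈ M.E,
      (ThmN.trianglesThrough M x).ncard ≤ 3 * (ThmN.triangles M).ncard / M.E.ncard := by
    by_contra hno
    have hall : ∀ x ∈ M.E,
        3 * (ThmN.triangles M).ncard / M.E.ncard + 1 ≤ (ThmN.trianglesThrough M x).ncard := by
      intro x hx
      by_contra h
      exact hno ⟨x, hx, by omega⟩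
    have h1 := mul_ncard_ground_le_three_mul_ncard_triangles M
      (3 * (ThmN.triangles M).ncard / M.E.ncard + 1) hall
    have h2 : 3 * (ThmN.triangles M).ncard <
        (3 * (ThmN.triangles M).ncard / M.E.ncard + 1) * M.E.ncard :=
      Nat.lt_mul_of_div_lt (Nat.lt_succ_self _) (by omega)
    omega
  -- delete `x`: nullity `d − 1`, at most `cq (d − 1)` triangles
  obtain ⟨d', rfl⟩ : ∃ d', d = d' + 1 := ⟨d - 1, by omega⟩
  obtain ⟨hd', hC1', hC2', hle⟩ :=
    ncard_triangles_le_add_of_not_isColoop M hC1 hC2 (d := d') hd hxE (hcol' x hxE)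
  have hC3' : ∀ X ⊆ (M ＼ {x}).E, (M ＼ {x}).eRk X ≤ 4 → X.ncard ≤ 10 := by
    intro X hX hr
    rw [_root_.Matroid.delete_ground] at hX
    rw [delete_singleton_eRk_eq hX] at hr
    exact hC3 X (hX.trans Set.sdiff_subset) hr
  have hlt : (M ＼ {x}).E.ncard < n := by
    rw [_root_.Matroid.delete_ground, ← hn]
    exact Set.ncard_sdiff_singleton_lt_of_mem hxE M.ground_finite
  have hrec := ih _ hlt (M ＼ {x}) rfl hC1' hC2' hC3' d' hd'
  -- `s ≤ ⌊3s/m⌋ + cq d' ≤ ⌊3s/m0⌋ + cq d'`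
  have hm0pos : 0 < m0 (d' + 1) := by have := four_le_m0 (d := d' + 1) (by omega); omega
  have hdiv : 3 * (ThmN.triangles M).ncard / M.E.ncard ≤
      3 * (ThmN.triangles M).ncard / m0 (d' + 1) := Nat.div_le_div_left hm0 hm0pos
  have hkey : (ThmN.triangles M).ncard ≤ 3 * (ThmN.triangles M).ncard / m0 (d' + 1) + cq d' := by
    omega
  -- `s ≤ 4·cq d'` since `m0 ≥ 4`
  have h4 : 3 * (ThmN.triangles M).ncard / m0 (d' + 1) ≤ 3 * (ThmN.triangles M).ncard / 4 :=
    Nat.div_le_div_left (four_le_m0 (by omega)) (by norm_num)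
  have hs4 : (ThmN.triangles M).ncard ≤ 4 * cq d' := by
    have := Nat.div_mul_le_self (3 * (ThmN.triangles M).ncard) 4
    omega
  exact cq_step d' (by omega) (by omega) hd4 _ (by omega) hkey

/-- **LEMMA Q on the `e`-free core**, in the set-builder vocabulary of `S1RowTwelve`: an `e`-free core of nullity
`d` has at most `cq d` triangles (`16 / 20 / 25 / 36` at `d = 8 / 9 / 10 / 12`). -/
theorem core_ncard_triangles_le_cq (M : Matroid α) [M.Finite]
    (hfree : ∀ e ∈ M.E, ∃ A ⊆ M.E \ {e}, e ∉ M.closure A ∧ e ∉ M.closure ((M.E \ {e}) \ A))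
    {d : ℕ} (hd : M.E.encard = M.eRank + d) :
    {C : Set α | M.IsCircuit C ∧ C.ncard = 3}.ncard ≤ cq d := by
  have hL : ∀ e ∈ M.E, ¬ M.IsLoop e := ThmN.not_isLoop_of_free M hfree
  have hline : ∀ L ⊆ M.E, M.eRk L = 2 → L.ncard ≤ 3 := by
    intro L hL' hr
    have := ThmN.ncard_add_one_le_two_pow_of_eRk_le M hL hfree 2 L hL' hr.le
    omega
  have hplane : ∀ P ⊆ M.E, M.eRk P ≤ 3 → P.ncard ≤ 6 := fun P hP hr =>
    ThmN.ncard_le_six_of_eRk_le_three_of_free M hfree hP hr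
  have hsolid : ∀ X ⊆ M.E, M.eRk X ≤ 4 → X.ncard ≤ 10 := fun X hX hr =>
    ThmN.ncard_le_ten_of_eRk_le_four_of_free M hfree hX hr
  exact ncard_triangles_le_cq M hline hplane hsolid hd

end S1

end PercRepro
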